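import Mathlib.Order.UpperLower.Basic
import Mathlib.Data.Finset.Powerset
import Mathlib.Data.Finset.Max
import Mathlib.Data.Finset.Card
import Mathlib.Data.Finset.SDiff
import Mathlib.Algebra.BigOperators.Group.Finset.Piecewise
import Mathlib.Algebra.Order.BigOperators.Group.Finset
import HarnessLib

/-!
# `NoHeavyLowerTail` (crux stmt-CriticalPhenomena-4575), P3 lane: THE STRONG TWISTED KLEITMAN INEQUALITY (all levels `s`)

Support file (seat `prim-l12-p3`, gen 36; `--supports stmt-CriticalPhenomena-4575`).  Memo
`run/shared/lean/prim/prim-l12/FROM-prim-l12-p3-g36-LAST-COORDINATE.md` §2.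

Let `α` be linearly ordered, `C, R ⊆ α` disjoint finite sets ("doubled" and "split" coordinates), and for `W ⊆ R` put
`x := C ∪ W`, `y := C ∪ (R \ W)` (a complementary pair in the link of `C`).  For a level `s : ℕ` the ORDER-`s` SPLICE of the pair is
`ψ̃_s(x, y) := {v ∈ x : #{w ∈ x : w ≤ v} ≤ s} ∪ {v ∈ y : s ≤ #{w ∈ x : w < v}}`
— if `#x ≥ s` this is "`x` up to its `s`-th element, `y` strictly beyond it" (the splice `x^{(s)}` of the ordered coefficientwise
conjecture (R*) of memos g35/g35s3), and if `#x < s` it is `x` itself.  It is written out definition-free in every statement.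
THEOREM (`card_compl_le_card_splice`, all `s`): for predicates `A, B` on finite sets that are monotone under inclusion,
    `#{W ⊆ R : A x ∧ B y} ≤ #{W ⊆ R : A x ∧ B (ψ̃_s(x, y))}`.
`s = 1, C = ∅` is the twisted Kleitman inequality of `…SahiCTCTwistedKleitman` (memo g35 §4); `s > #(C ∪ R)` (`ψ̃_s(x,y) = x`) is the top
squarefree coefficient of Harris/Kleitman, `#{x ∈ A : complement ∈ B} ≤ #{x ∈ A ∩ B}`; the family interpolates between the two.
Proof: induction on `C ∪ R` peeling its MAXIMUM `n` (not the minimum as in g35): for `n ∈ C` the instance is the `(A(·+n), B(·+n))`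
instance one size down; for `n ∈ R` the two halves `n ∈ W` / `n ∉ W` are bounded by the CROSS instances `(A(·+n), B)` and `(A, B(·+n))`
one size down, after which the remainder is `Σ_{#x' < s} (A(x'+n) − A(x'))·(B(ψ'+n) − B(ψ')) ≥ 0` pointwise.
In the slot calculus of memo g35s3 this is the atom inequality `E(A,B;s,u) + Σ_{ℓ<s} L(A,B;ℓ,u) ≥ Y(A,B;u)` for ALL `(s,u)`, per `z`.
Nothing is asserted about the crux.
-/

namespace Summit.CriticalPhenomena.PercolationContinuityZ3.Theorems

namespace SahiCTCStrongTwistedKleitman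

open Finset

variable {α : Type*} [LinearOrder α]

/-- Pointwise bookkeeping of the induction step: for Booleans with `a₀ → a₁`, `b₀ → b₁`,
`[a₀ ∧ b₁] + [a₁ ∧ b₀] ≤ [a₀ ∧ b₀] + [a₁ ∧ b₁]`. [this work] -/
theorem ite_cross_le (a₀ a₁ b₀ b₁ : Prop) [Decidable a₀] [Decidable a₁] [Decidable b₀] [Decidable b₁]
    (ha : a₀ → a₁) (hb : b₀ → b₁) :
    (if a₀ ∧ b₁ then 1 else 0) + (if a₁ ∧ b₀ then 1 else 0) ≤ (if a₀ ∧ b₀ then (1 : ℕ) else 0) + (if a₁ ∧ b₁ then 1 else 0) := by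
  by_cases h0 : a₀ <;> by_cases h1 : a₁ <;> by_cases g0 : b₀ <;> by_cases g1 : b₁ <;> simp [h0, h1, g0, g1]
  · exact h1 (ha h0)
  · exact g1 (hb g0)

/-- Rank filters do not see a new maximum: `{w ∈ x' ∪ {n} : w ≤ v} = {w ∈ x' : w ≤ v}` for `v < n`. [this work] -/
theorem filter_le_insert_of_lt {n v : α} (x' : Finset α) (hv : v < n) :
    ((insert n x').filter fun w => w ≤ v) = x'.filter fun w => w ≤ v := by
  rw [filter_insert, if_neg (not_le.mpr hv)]

/-- `{w ∈ x' ∪ {n} : w < v} = {w ∈ x' : w < v}` for `v ≤ n`. [this work] -/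
theorem filter_lt_insert_of_le {n v : α} (x' : Finset α) (hv : v ≤ n) :
    ((insert n x').filter fun w => w < v) = x'.filter fun w => w < v := by
  rw [filter_insert, if_neg (not_lt.mpr hv)]

/-- The splice lies inside `x ∪ y`. [this work] -/
theorem splice_subset_union (s : ℕ) (x y : Finset α) :
    ((x.filter fun v => (x.filter fun w => w ≤ v).card ≤ s) ∪ (y.filter fun v => s ≤ (x.filter fun w => w < v).card)) ⊆ x ∪ y :=
  union_subset_union (filter_subset _ _) (filter_subset _ _)

/-- Adding a new maximum `n` to `x'` only: it enters the splice iff `#x' + 1 ≤ s` (it is then among the first `s` elements of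
`x' ∪ {n}`); nothing else changes. [this work] -/
theorem splice_insert_left (s : ℕ) {n : α} {x' y' : Finset α} (hx : ∀ w ∈ x', w < n) (hy : ∀ w ∈ y', w < n) :
    (((insert n x').filter fun v => ((insert n x').filter fun w => w ≤ v).card ≤ s) ∪
      (y'.filter fun v => s ≤ ((insert n x').filter fun w => w < v).card)) =
    if x'.card + 1 ≤ s then
      insert n ((x'.filter fun v => (x'.filter fun w => w ≤ v).card ≤ s) ∪ (y'.filter fun v => s ≤ (x'.filter fun w => w < v).card))
    else ((x'.filter fun v => (x'.filter fun w => w ≤ v).card ≤ s) ∪ (y'.filter fun v => s ≤ (x'.filter fun w => w < v).card)) := by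
  have hnx : n ∉ x' := fun h => lt_irrefl n (hx n h)
  have hny : n ∉ y' := fun h => lt_irrefl n (hy n h)
  have htop : ((insert n x').filter fun w => w ≤ n) = insert n x' :=
    filter_true_of_mem fun w hw => by
      rcases mem_insert.mp hw with rfl | hw
      · exact le_rfl
      · exact le_of_lt (hx w hw)
  ext v
  by_cases hvn : v = n
  · subst hvn
    have key : v ∈ (((insert v x').filter fun u => ((insert v x').filter fun w => w ≤ u).card ≤ s) ∪
        (y'.filter fun u => s ≤ ((insert v x').filter fun w => w < u).card)) ↔ x'.card + 1 ≤ s := by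
      rw [mem_union, mem_filter, mem_filter, htop, card_insert_of_notMem hnx]
      constructor
      · rintro (⟨_, h⟩ | ⟨h, _⟩)
        · exact h
        · exact absurd h hny
      · intro h; exact Or.inl ⟨mem_insert_self v x', h⟩
    rw [key]
    split_ifs with h
    · simp only [mem_insert, true_or, h]
    · simp only [h, false_iff]
      intro hmem
      rcases mem_union.mp (splice_subset_union s x' y' hmem) with h1 | h1
      · exact hnx h1
      · exact hny h1
  · -- v ≠ n: either v is above n (then it is nowhere) or below (then the rank filters agree)
    rcases lt_or_gt_of_ne hvn with hlt | hgt
    · have e1 := filter_le_insert_of_lt x' hlt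
      have e2 := filter_lt_insert_of_le x' (le_of_lt hlt)
      have base : v ∈ (((insert n x').filter fun u => ((insert n x').filter fun w => w ≤ u).card ≤ s) ∪
          (y'.filter fun u => s ≤ ((insert n x').filter fun w => w < u).card)) ↔
          v ∈ ((x'.filter fun u => (x'.filter fun w => w ≤ u).card ≤ s) ∪ (y'.filter fun u => s ≤ (x'.filter fun w => w < u).card)) := by
        simp only [mem_union, mem_filter, mem_insert, e1, e2, hvn, false_or]
      rw [base]
      split_ifs with h
      · rw [mem_insert]; simp only [hvn, false_or]
      · rfl
    · -- n < v: v belongs to none of the sets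
      have hvx : v ∉ x' := fun h => lt_asymm hgt (hx v h)
      have hvy : v ∉ y' := fun h => lt_asymm hgt (hy v h)
      have hvx' : v ∉ insert n x' := fun h => by
        rcases mem_insert.mp h with h | h
        · exact hvn h
        · exact hvx h
      have lhs : v ∉ (((insert n x').filter fun u => ((insert n x').filter fun w => w ≤ u).card ≤ s) ∪
          (y'.filter fun u => s ≤ ((insert n x').filter fun w => w < u).card)) := fun h => by
        rcases mem_union.mp h with h | h
        · exact hvx' (mem_filter.mp h).1
        · exact hvy (mem_filter.mp h).1
      have rhs : v ∉ ((x'.filter fun u => (x'.filter fun w => w ≤ u).card ≤ s) ∪ (y'.filter fun u => s ≤ (x'.filter fun w => w < u).card)) :=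
        fun h => by
          rcases mem_union.mp (splice_subset_union s x' y' h) with h | h
          · exact hvx h
          · exact hvy h
      simp only [lhs, false_iff]
      split_ifs
      · rw [mem_insert]; rintro (h | h); exacts [hvn h, rhs h]
      · exact rhs

/-- Adding a new maximum `n` to `y'` only: it enters the splice iff `s ≤ #x'`. [this work] -/
theorem splice_insert_right (s : ℕ) {n : α} {x' y' : Finset α} (hx : ∀ w ∈ x', w < n) (hy : ∀ w ∈ y', w < n) :
    ((x'.filter fun v => (x'.filter fun w => w ≤ v).card ≤ s) ∪
      ((insert n y').filter fun v => s ≤ (x'.filter fun w => w < v).card)) =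
    if s ≤ x'.card then
      insert n ((x'.filter fun v => (x'.filter fun w => w ≤ v).card ≤ s) ∪ (y'.filter fun v => s ≤ (x'.filter fun w => w < v).card))
    else ((x'.filter fun v => (x'.filter fun w => w ≤ v).card ≤ s) ∪ (y'.filter fun v => s ≤ (x'.filter fun w => w < v).card)) := by
  have hnx : n ∉ x' := fun h => lt_irrefl n (hx n h)
  have hny : n ∉ y' := fun h => lt_irrefl n (hy n h)
  have htop : (x'.filter fun w => w < n) = x' := filter_true_of_mem fun w hw => hx w hw
  ext v
  by_cases hvn : v = n
  · subst hvn
    have key : v ∈ ((x'.filter fun u => (x'.filter fun w => w ≤ u).card ≤ s) ∪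
        ((insert v y').filter fun u => s ≤ (x'.filter fun w => w < u).card)) ↔ s ≤ x'.card := by
      rw [mem_union, mem_filter, mem_filter, htop]
      constructor
      · rintro (⟨h, _⟩ | ⟨_, h⟩)
        · exact absurd h hnx
        · exact h
      · intro h; exact Or.inr ⟨mem_insert_self v y', h⟩
    rw [key]
    split_ifs with h
    · simp only [mem_insert, true_or, h]
    · simp only [h, false_iff]
      intro hmem
      rcases mem_union.mp (splice_subset_union s x' y' hmem) with h1 | h1
      · exact hnx h1
      · exact hny h1
  · have base : v ∈ ((x'.filter fun u => (x'.filter fun w => w ≤ u).card ≤ s) ∪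
        ((insert n y').filter fun u => s ≤ (x'.filter fun w => w < u).card)) ↔
        v ∈ ((x'.filter fun u => (x'.filter fun w => w ≤ u).card ≤ s) ∪ (y'.filter fun u => s ≤ (x'.filter fun w => w < u).card)) := by
      simp only [mem_union, mem_filter, mem_insert, hvn, false_or]
    rw [base]
    split_ifs with h
    · rw [mem_insert]; simp only [hvn, false_or]
    · rfl

/-- Adding a new maximum `n` to both `x'` and `y'`: it always enters the splice. [this work] -/
theorem splice_insert_both (s : ℕ) {n : α} {x' y' : Finset α} (hx : ∀ w ∈ x', w < n) (hy : ∀ w ∈ y', w < n) :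
    (((insert n x').filter fun v => ((insert n x').filter fun w => w ≤ v).card ≤ s) ∪
      ((insert n y').filter fun v => s ≤ ((insert n x').filter fun w => w < v).card)) =
    insert n ((x'.filter fun v => (x'.filter fun w => w ≤ v).card ≤ s) ∪ (y'.filter fun v => s ≤ (x'.filter fun w => w < v).card)) := by
  have hnx : n ∉ x' := fun h => lt_irrefl n (hx n h)
  have htop : ((insert n x').filter fun w => w ≤ n) = insert n x' :=
    filter_true_of_mem fun w hw => by
      rcases mem_insert.mp hw with rfl | hw
      · exact le_rfl
      · exact le_of_lt (hx w hw)
  have htop' : ((insert n x').filter fun w => w < n) = x' := by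
    rw [filter_insert, if_neg (lt_irrefl n)]; exact filter_true_of_mem fun w hw => hx w hw
  ext v
  by_cases hvn : v = n
  · subst hvn
    simp only [mem_union, mem_filter, mem_insert, true_or, true_and, htop, htop', card_insert_of_notMem hnx, iff_true]
    omega
  · rcases lt_or_gt_of_ne hvn with hlt | hgt
    · have e1 := filter_le_insert_of_lt x' hlt
      have e2 := filter_lt_insert_of_le x' (le_of_lt hlt)
      simp only [mem_union, mem_filter, mem_insert, e1, e2, hvn, false_or]
    · have hvx : v ∉ x' := fun h => lt_asymm hgt (hx v h)
      have hvy : v ∉ y' := fun h => lt_asymm hgt (hy v h)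
      simp only [mem_union, mem_filter, mem_insert, hvn, hvx, hvy, false_and, or_self]

/-- **THE STRONG TWISTED KLEITMAN INEQUALITY**, predicate form (all levels `s`; memo g36 §2): for predicates `A, B` on
finite subsets of a linear order that are monotone under inclusion, and disjoint finite `C, R`,
`#{W ⊆ R : A (C ∪ W) ∧ B (C ∪ (R \ W))} ≤ #{W ⊆ R : A (C ∪ W) ∧ B (ψ̃_s(C ∪ W, C ∪ (R \ W)))}` with the order-`s` splice
`ψ̃_s(x,y) = {v ∈ x : #{w ∈ x : w ≤ v} ≤ s} ∪ {v ∈ y : s ≤ #{w ∈ x : w < v}}`. [this work] -/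
theorem card_compl_le_card_splice (s : ℕ) (V : Finset α) :
    ∀ (A B : Finset α → Prop) [DecidablePred A] [DecidablePred B],
      (∀ S T : Finset α, S ⊆ T → A S → A T) → (∀ S T : Finset α, S ⊆ T → B S → B T) →
      ∀ (C R : Finset α), Disjoint C R → C ∪ R = V →
        (R.powerset.filter fun W => A (C ∪ W) ∧ B (C ∪ (R \ W))).card ≤
        (R.powerset.filter fun W => A (C ∪ W) ∧
          B (((C ∪ W).filter fun v => ((C ∪ W).filter fun w => w ≤ v).card ≤ s) ∪
             ((C ∪ (R \ W)).filter fun v => s ≤ ((C ∪ W).filter fun w => w < v).card))).card := by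
  induction V using Finset.induction_on_max with
  | empty =>
    intro A B _ _ _ _ C R _ hCR
    obtain ⟨rfl, rfl⟩ := union_eq_empty.mp hCR
    apply le_of_eq
    apply congrArg Finset.card
    apply filter_congr
    intro W hW
    rw [powerset_empty, mem_singleton] at hW
    subst hW
    simp
  | insert n V' hlt ih =>
    intro A B _ _ hA hB C R hdis hCR
    have hnV' : n ∉ V' := fun h => lt_irrefl n (hlt n h)
    have hn : n ∈ C ∪ R := by rw [hCR]; exact mem_insert_self n V'
    rcases mem_union.mp hn with hnC | hnR
    · ----------------------------------------------------------------- n ∈ C (doubled coordinate)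
      have hnR : n ∉ R := fun h => disjoint_left.mp hdis hnC h
      set C' := C.erase n with hC'_def
      have hC : C = insert n C' := by rw [hC'_def, insert_erase hnC]
      have hnC' : n ∉ C' := by rw [hC'_def]; exact notMem_erase n C
      have hdis' : Disjoint C' R := disjoint_of_subset_left (erase_subset n C) hdis
      have hCR' : C' ∪ R = V' := by
        have : (C ∪ R).erase n = (insert n V').erase n := by rw [hCR]
        rwa [erase_insert hnV', hC, insert_union, erase_insert] at this
        rw [mem_union, not_or]; exact ⟨hnC', hnR⟩
      have hsub : ∀ W : Finset α, W ⊆ R → ∀ w ∈ C' ∪ W, w < n := fun W hW w hw => by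
        apply hlt; rw [← hCR']; rcases mem_union.mp hw with h | h
        · exact mem_union_left _ h
        · exact mem_union_right _ (hW h)
      have IH := ih (fun S => A (insert n S)) (fun S => B (insert n S))
        (fun S T hST h => hA _ _ (insert_subset_insert n hST) h) (fun S T hST h => hB _ _ (insert_subset_insert n hST) h)
        C' R hdis' hCR'
      have eL : (R.powerset.filter fun W => A (C ∪ W) ∧ B (C ∪ (R \ W))) =
          R.powerset.filter fun W => A (insert n (C' ∪ W)) ∧ B (insert n (C' ∪ (R \ W))) := by
        apply filter_congr; intro W _; rw [hC, insert_union, insert_union]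
      have eR : (R.powerset.filter fun W => A (C ∪ W) ∧
            B (((C ∪ W).filter fun v => ((C ∪ W).filter fun w => w ≤ v).card ≤ s) ∪
              ((C ∪ (R \ W)).filter fun v => s ≤ ((C ∪ W).filter fun w => w < v).card))) =
          R.powerset.filter fun W => A (insert n (C' ∪ W)) ∧
            B (insert n (((C' ∪ W).filter fun v => ((C' ∪ W).filter fun w => w ≤ v).card ≤ s) ∪
              ((C' ∪ (R \ W)).filter fun v => s ≤ ((C' ∪ W).filter fun w => w < v).card))) := by
        apply filter_congr; intro W hW
        rw [hC, insert_union, insert_union,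
          splice_insert_both s (hsub W (mem_powerset.mp hW)) (hsub (R \ W) sdiff_subset)]
      rw [eL, eR]
      exact IH
    · ----------------------------------------------------------------- n ∈ R (split coordinate)
      have hnC : n ∉ C := fun h => disjoint_left.mp hdis h hnR
      set R' := R.erase n with hR'_def
      have hR : R = insert n R' := by rw [hR'_def, insert_erase hnR]
      have hnR' : n ∉ R' := by rw [hR'_def]; exact notMem_erase n R
      have hdis' : Disjoint C R' := disjoint_of_subset_right (erase_subset n R) hdis
      have hCR' : C ∪ R' = V' := by
        have : (C ∪ R).erase n = (insert n V').erase n := by rw [hCR]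
        rwa [erase_insert hnV', hR, union_insert, erase_insert] at this
        rw [mem_union, not_or]; exact ⟨hnC, hnR'⟩
      have hsubx : ∀ W : Finset α, W ⊆ R' → ∀ w ∈ C ∪ W, w < n := fun W hW w hw => by
        apply hlt; rw [← hCR']; rcases mem_union.mp hw with h | h
        · exact mem_union_left _ h
        · exact mem_union_right _ (hW h)
      -- the two cross instances one size down
      have IH01 := ih A (fun S => B (insert n S)) hA (fun S T hST h => hB _ _ (insert_subset_insert n hST) h) C R' hdis' hCR'
      have IH10 := ih (fun S => A (insert n S)) B (fun S T hST h => hA _ _ (insert_subset_insert n hST) h) hB C R' hdis' hCR'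
      -- split the powerset of R = insert n R'
      rw [hR, powerset_insert]
      have hdisj : Disjoint R'.powerset (R'.powerset.image (insert n)) := by
        rw [disjoint_left]
        intro W hW hW'
        rw [mem_image] at hW'
        obtain ⟨W', _, rfl⟩ := hW'
        exact hnR' (mem_powerset.mp hW (mem_insert_self n W'))
      rw [filter_union, filter_union, card_union_of_disjoint (disjoint_filter_filter hdisj),
        card_union_of_disjoint (disjoint_filter_filter hdisj)]
      have hinj : Set.InjOn (insert n) (R'.powerset : Set (Finset α)) := by
        intro W₁ hW₁ W₂ hW₂ h
        have h1 : n ∉ W₁ := fun hh => hnR' (mem_powerset.mp (mem_coe.mp hW₁) hh)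
        have h2 : n ∉ W₂ := fun hh => hnR' (mem_powerset.mp (mem_coe.mp hW₂) hh)
        rw [← erase_insert h1, ← erase_insert h2, h]
      -- piece n ∉ W:  x = C ∪ W,  y = (C ∪ (R' \ W)) ∪ {n}
      have p0L : (R'.powerset.filter fun W => A (C ∪ W) ∧ B (C ∪ (insert n R' \ W))) =
          R'.powerset.filter fun W => A (C ∪ W) ∧ B (insert n (C ∪ (R' \ W))) := by
        apply filter_congr; intro W hW
        rw [insert_sdiff_of_notMem R' (fun h => hnR' (mem_powerset.mp hW h)), union_insert]
      have p0R : (R'.powerset.filter fun W => A (C ∪ W) ∧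
            B (((C ∪ W).filter fun v => ((C ∪ W).filter fun w => w ≤ v).card ≤ s) ∪
              ((C ∪ (insert n R' \ W)).filter fun v => s ≤ ((C ∪ W).filter fun w => w < v).card))) =
          R'.powerset.filter fun W => A (C ∪ W) ∧
            B (if s ≤ (C ∪ W).card then
                insert n (((C ∪ W).filter fun v => ((C ∪ W).filter fun w => w ≤ v).card ≤ s) ∪
                  ((C ∪ (R' \ W)).filter fun v => s ≤ ((C ∪ W).filter fun w => w < v).card))
               else (((C ∪ W).filter fun v => ((C ∪ W).filter fun w => w ≤ v).card ≤ s) ∪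
                  ((C ∪ (R' \ W)).filter fun v => s ≤ ((C ∪ W).filter fun w => w < v).card))) := by
        apply filter_congr; intro W hW
        have hW' := mem_powerset.mp hW
        rw [insert_sdiff_of_notMem R' (fun h => hnR' (hW' h)), union_insert,
          splice_insert_right s (hsubx W hW') (hsubx (R' \ W) sdiff_subset)]
      -- piece n ∈ W:  x = (C ∪ W') ∪ {n},  y = C ∪ (R' \ W')
      have p1L : ((R'.powerset.image (insert n)).filter fun W => A (C ∪ W) ∧ B (C ∪ (insert n R' \ W))).card =
          (R'.powerset.filter fun W => A (insert n (C ∪ W)) ∧ B (C ∪ (R' \ W))).card := by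
        rw [filter_image, card_image_of_injOn (fun x hx y hy h => hinj (mem_coe.mpr (mem_filter.mp (mem_coe.mp hx)).1)
          (mem_coe.mpr (mem_filter.mp (mem_coe.mp hy)).1) h)]
        congr 1
        apply filter_congr; intro W hW
        rw [insert_sdiff_insert, sdiff_insert_of_notMem hnR', union_insert]
      have p1R : ((R'.powerset.image (insert n)).filter fun W => A (C ∪ W) ∧
            B (((C ∪ W).filter fun v => ((C ∪ W).filter fun w => w ≤ v).card ≤ s) ∪
              ((C ∪ (insert n R' \ W)).filter fun v => s ≤ ((C ∪ W).filter fun w => w < v).card))).card =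
          (R'.powerset.filter fun W => A (insert n (C ∪ W)) ∧
            B (if (C ∪ W).card + 1 ≤ s then
                insert n (((C ∪ W).filter fun v => ((C ∪ W).filter fun w => w ≤ v).card ≤ s) ∪
                  ((C ∪ (R' \ W)).filter fun v => s ≤ ((C ∪ W).filter fun w => w < v).card))
               else (((C ∪ W).filter fun v => ((C ∪ W).filter fun w => w ≤ v).card ≤ s) ∪
                  ((C ∪ (R' \ W)).filter fun v => s ≤ ((C ∪ W).filter fun w => w < v).card)))).card := by
        rw [filter_image, card_image_of_injOn (fun x hx y hy h => hinj (mem_coe.mpr (mem_filter.mp (mem_coe.mp hx)).1)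
          (mem_coe.mpr (mem_filter.mp (mem_coe.mp hy)).1) h)]
        congr 1
        apply filter_congr; intro W hW
        have hW' := mem_powerset.mp hW
        rw [insert_sdiff_insert, sdiff_insert_of_notMem hnR', union_insert,
          splice_insert_left s (hsubx W hW') (hsubx (R' \ W) sdiff_subset)]
      rw [p0L, p0R, p1L, p1R]
      -- IH bounds the two left pieces by the 'cross' spliced counts
      refine le_trans (Nat.add_le_add IH01 IH10) ?_
      -- the rest is pointwise
      rw [card_filter, card_filter, card_filter, card_filter, ← sum_add_distrib, ← sum_add_distrib]
      apply sum_le_sum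
      intro W hW
      by_cases hs : s ≤ (C ∪ W).card
      · have hs' : ¬ ((C ∪ W).card + 1 ≤ s) := by omega
        rw [if_pos hs, if_neg hs']
      · have hs' : (C ∪ W).card + 1 ≤ s := by omega
        rw [if_neg hs, if_pos hs']
        exact ite_cross_le _ _ _ _ (hA _ _ (subset_insert n _)) (hB _ _ (subset_insert n _))

/-- **THE STRONG TWISTED KLEITMAN INEQUALITY** for up-sets of finite sets (all levels `s`): with `x = C ∪ W`, `y = C ∪ (R \ W)`,
`#{W ⊆ R : x ∈ 𝒜, y ∈ ℬ} ≤ #{W ⊆ R : x ∈ 𝒜, ψ̃_s(x,y) ∈ ℬ}`.  `s = 1`, `C = ∅`: twisted Kleitman (g35); `s > #(C ∪ R)`: the top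
squarefree coefficient of Harris–Kleitman. [this work] -/
theorem card_compl_mem_le_card_splice_mem (s : ℕ) (𝒜 ℬ : Finset (Finset α))
    (h𝒜 : IsUpperSet (𝒜 : Set (Finset α))) (hℬ : IsUpperSet (ℬ : Set (Finset α))) (C R : Finset α) (hCR : Disjoint C R) :
    (R.powerset.filter fun W => C ∪ W ∈ 𝒜 ∧ C ∪ (R \ W) ∈ ℬ).card ≤
    (R.powerset.filter fun W => C ∪ W ∈ 𝒜 ∧
      (((C ∪ W).filter fun v => ((C ∪ W).filter fun w => w ≤ v).card ≤ s) ∪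
        ((C ∪ (R \ W)).filter fun v => s ≤ ((C ∪ W).filter fun w => w < v).card)) ∈ ℬ).card :=
  card_compl_le_card_splice s (C ∪ R) (fun S => S ∈ 𝒜) (fun S => S ∈ ℬ)
    (fun S T hST h => h𝒜 (show S ≤ T from hST) h) (fun S T hST h => hℬ (show S ≤ T from hST) h) C R hCR rfl

end SahiCTCStrongTwistedKleitman

end Summit.CriticalPhenomena.PercolationContinuityZ3.Theorems
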